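import Literature.Geometry.Riemannian.ColdingSyntheticRealization
import HarnessLib

/-!
# Colding's almost isometry, synthetic form (Colding 1996a, §2): `cos d(y, z) ≈ ⟨Φ(y), Φ(z)⟩`

The analysis half of the Gromov–Hausdorff assembly in Colding's volume sphere theorem
(`Colding1996_volume_ghClose`), in a pseudometric space `(M, d)` with `d ≤ π` (compare
`ColdingSyntheticFrameExtension.lean`, `ColdingSyntheticRealization.lean`). Data: an `α`-frame
`x_0, …, x_n` with `η`-antipodes; a COARSE antipodal relation for arbitrary almost antipodal
pairs (`d(p, q) ≥ π − ψ₀ ⇒ sup_w |cos d(p, w) + cos d(q, w)| ≤ η₂`); for a point `y`, continuous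
good paths (`β`, `r`) near every pair for the functions `cos d_{x_i}` and `cos d_y`; and the
two-sided Parseval bound `|Σ_i cos² d(x_i, z) − 1| ≤ ψ_P` at every `z`. Conclusion
(`abs_cos_dist_sub_sum_le`): for every `z`,
`|cos d(y, z) − Σ_i cos d(x_i, y) cos d(x_i, z)| ≤ 5ⁿ⁺¹ (D + 4(n+3) ε₄)`,
`D = π√(γ/2) + η₂ + γ + n √(2γ + ψ_P)`, `ε₄ = 6ε/√(γ/2)`, for a free non-degeneracy threshold
`γ ∈ (0, 1]` and `ε ≥ α, β, η, r` explicitly small against `γ`.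

The proof is a downward induction on `j`: CLAIM_j — for `z` whose coordinates below `j` are small,
`cos d(y, z) ≈ Σ_{i ≥ j} cos d(x_i, y) cos d(x_i, z)`. If `|cos d(x_j, z)| ≥ 1 − γ` the point `z`
is close to `x_j` (Lipschitz) or almost antipodal to it (coarse relation at `w = y`), and Parseval
makes the other coordinates `O(√γ)` (`abs_cos_dist_sub_sum_le_of_degenerate`); this is also the
base `j = n`, where Parseval forces `|cos d(x_n, z)| ≥ 1 − γ`. Otherwise (`analysis_step`) walk
from (a perturbation of) `x̄_j` or `x_j` — whichever has `cos d(·, z) = −|cos d(x_j, z)|` — to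
(a perturbation of) `z` along the good path; `cos d_{x_j}` crosses zero at some `q` (IVT), where
the laws give `cos d_{x_i}(q) ≈ B cos d_{x_i}(z)` (`i ≠ j`) and
`cos d_y(q) ≈ B (cos d_y(z) − cos d(x_j, z) cos d(x_j, y))` with `B ≥ 1/4`
(`sin((1−s)ℓ) + sin(sℓ) ≥ sin ℓ`), using `cos d_y(x_j) = cos d(x_j, y)` (SYMMETRY of `d`);
CLAIM_{j+1} at `q` and division by `B` give CLAIM_j at `z`.

Everything here is proved; no definitions, no named facts (D-0026).

## References

* T. H. Colding, *Shape of manifolds with positive Ricci curvature*, Invent. Math. 124 (1996)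
  175–191, §2. [Colding1996Shape]
-/

noncomputable section

open Set Filter
open scoped BigOperators Topology

namespace Literature.Geometry.Riemannian

namespace ColdingSynthetic

/-! ### Real lemmas -/

/-- `sin ℓ ≤ sin((1−s)ℓ) + sin(sℓ)` for `s ∈ [0,1]`, `ℓ ∈ [0, π]` (addition formula, `cos ≤ 1`).
[folklore] -/
theorem sin_le_sin_add_sin {ℓ s : ℝ} (hℓ0 : 0 ≤ ℓ) (hℓπ : ℓ ≤ Real.pi) (hs0 : 0 ≤ s) (hs1 : s ≤ 1) :
    Real.sin ℓ ≤ Real.sin ((1 - s) * ℓ) + Real.sin (s * ℓ) := by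
  have h1 : Real.sin ℓ = Real.sin ((1 - s) * ℓ) * Real.cos (s * ℓ) +
      Real.cos ((1 - s) * ℓ) * Real.sin (s * ℓ) := by
    rw [← Real.sin_add]; ring_nf
  have hA : 0 ≤ Real.sin ((1 - s) * ℓ) :=
    Real.sin_nonneg_of_nonneg_of_le_pi (by nlinarith) (by nlinarith)
  have hB : 0 ≤ Real.sin (s * ℓ) :=
    Real.sin_nonneg_of_nonneg_of_le_pi (by nlinarith) (by nlinarith)
  rw [h1]
  nlinarith [Real.cos_le_one (s * ℓ), Real.cos_le_one ((1 - s) * ℓ)]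

/-- `d ∈ [0, π]`, `1 − cos d ≤ γ ⇒ d ≤ π √(γ/2)` (`1 − cos d = 2 sin²(d/2)` and Jordan). [folklore] -/
theorem le_pi_mul_sqrt_of_one_sub_cos_le {d γ : ℝ} (hd0 : 0 ≤ d) (hdπ : d ≤ Real.pi)
    (h : 1 - Real.cos d ≤ γ) : d ≤ Real.pi * Real.sqrt (γ / 2) := by
  have h1 : 1 - Real.cos d = 2 * Real.sin (d / 2) ^ 2 := by
    have h2 : Real.cos d = 1 - 2 * Real.sin (d / 2) ^ 2 := by
      conv_lhs => rw [show d = 2 * (d / 2) by ring, Real.cos_two_mul, Real.cos_sq']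
      ring
    linarith only [h2]
  have h2 : 2 / Real.pi * (d / 2) ≤ Real.sin (d / 2) :=
    Real.mul_le_sin (by linarith) (by linarith)
  have h3 : 0 ≤ 2 / Real.pi * (d / 2) := by positivity
  have h4 : (2 / Real.pi * (d / 2)) ^ 2 ≤ Real.sin (d / 2) ^ 2 := pow_le_pow_left₀ h3 h2 2
  have h5 : (2 / Real.pi * (d / 2)) ^ 2 = d ^ 2 / Real.pi ^ 2 := by field_simp
  have hγ : d ^ 2 / Real.pi ^ 2 ≤ γ / 2 := by rw [← h5]; linarith
  have h6 : d ^ 2 ≤ (Real.pi * Real.sqrt (γ / 2)) ^ 2 := by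
    rw [mul_pow, Real.sq_sqrt (by
      have : 0 ≤ d ^ 2 / Real.pi ^ 2 := by positivity
      linarith)]
    rw [div_le_iff₀ (by positivity)] at hγ
    linarith
  have h7 : 0 ≤ Real.pi * Real.sqrt (γ / 2) := by positivity
  exact le_of_pow_le_pow_left₀ two_ne_zero h7 h6

variable {M : Type*} [PseudoMetricSpace M]

/-! ### The degenerate case: `|cos d(x_j, z)| ≥ 1 − γ` -/

/-- **The degenerate case.** If `|cos d(x_j, z)| ≥ 1 − γ` then, with `c_i = cos d(x_i, y)` and any
finite set `S ∋ j` of indices, `|cos d(y, z) − Σ_{i ∈ S} c_i cos d(x_i, z)| ≤ π√(γ/2) + η₂ + γ + n √(2γ + ψ_P)`: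
`z` is `π√(γ/2)`-close to `x_j` (`cos d(x_j, z) ≥ 1 − γ`; then `cos d(y, z) ≈ c_j`) or almost
antipodal to it (coarse relation at `w = y`: `cos d(y, z) ≈ −c_j`), while the Parseval upper
bound makes every other coordinate `≤ √(2γ + ψ_P)`. [cite: Colding1996Shape, §2] -/
theorem abs_cos_dist_sub_sum_le_of_degenerate {n : ℕ} (x : Fin (n + 1) → M) (y z : M)
    {γ ψ₀ η₂ ψP : ℝ} (hψP : 0 ≤ ψP) (hη₂ : 0 ≤ η₂)
    (hψ₀ : Real.pi * Real.sqrt (γ / 2) ≤ ψ₀)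
    (hdiam : ∀ a b : M, dist a b ≤ Real.pi)
    (hanti2 : ∀ p q : M, Real.pi - ψ₀ ≤ dist p q →
      ∀ w, |Real.cos (dist p w) + Real.cos (dist q w)| ≤ η₂)
    (hP : ∑ i, Real.cos (dist (x i) z) ^ 2 ≤ 1 + ψP)
    (j : Fin (n + 1)) (hj : 1 - γ ≤ |Real.cos (dist (x j) z)|)
    (S : Finset (Fin (n + 1))) (hS : j ∈ S) :
    |Real.cos (dist y z) - ∑ i ∈ S, Real.cos (dist (x i) y) * Real.cos (dist (x i) z)| ≤
      Real.pi * Real.sqrt (γ / 2) + η₂ + γ + n * Real.sqrt (2 * γ + ψP) := by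
  classical
  set a : ℝ := Real.cos (dist (x j) z) with ha
  have ha1 : |a| ≤ 1 := Real.abs_cos_le_one _
  -- the other coordinates are small
  have hother : ∀ i, i ≠ j → |Real.cos (dist (x i) z)| ≤ Real.sqrt (2 * γ + ψP) := by
    intro i hi
    have h1 : Real.cos (dist (x i) z) ^ 2 + a ^ 2 ≤ 1 + ψP := by
      have h2 : ∑ i' ∈ ({i, j} : Finset (Fin (n + 1))), Real.cos (dist (x i') z) ^ 2 ≤
          ∑ i', Real.cos (dist (x i') z) ^ 2 :=
        Finset.sum_le_sum_of_subset_of_nonneg (Finset.subset_univ _) fun i' _ _ ↦ sq_nonneg _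
      rw [Finset.sum_pair hi, ← ha] at h2
      exact h2.trans hP
    have h5 : Real.cos (dist (x i) z) ^ 2 ≤ 2 * γ + ψP := by
      rcases le_or_gt 0 (1 - γ) with h4 | h4
      · have h3 : (1 - γ) ^ 2 ≤ a ^ 2 := by
          rw [← sq_abs a]; exact pow_le_pow_left₀ h4 hj 2
        nlinarith only [h1, h3, hψP, sq_nonneg γ]
      · have h6 : Real.cos (dist (x i) z) ^ 2 ≤ 1 := by
          rw [sq_le_one_iff_abs_le_one]; exact Real.abs_cos_le_one _
        linarith only [h6, h4, hψP]
    rw [← Real.sqrt_sq_eq_abs]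
    exact Real.sqrt_le_sqrt h5
  -- the tail of the sum
  have htail : |∑ i ∈ S.erase j, Real.cos (dist (x i) y) * Real.cos (dist (x i) z)| ≤
      n * Real.sqrt (2 * γ + ψP) := by
    refine (Finset.abs_sum_le_sum_abs _ _).trans ?_
    have h1 : ∀ i ∈ S.erase j, |Real.cos (dist (x i) y) * Real.cos (dist (x i) z)| ≤
        Real.sqrt (2 * γ + ψP) := by
      intro i hi
      rw [abs_mul]
      have h2 := hother i (Finset.ne_of_mem_erase hi)
      have h3 := Real.abs_cos_le_one (dist (x i) y)
      calc |Real.cos (dist (x i) y)| * |Real.cos (dist (x i) z)| ≤ 1 * Real.sqrt (2 * γ + ψP) :=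
            mul_le_mul h3 h2 (abs_nonneg _) zero_le_one
        _ = _ := one_mul _
    refine (Finset.sum_le_card_nsmul _ _ _ h1).trans ?_
    rw [nsmul_eq_mul]
    refine mul_le_mul_of_nonneg_right ?_ (Real.sqrt_nonneg _)
    have h4 : (S.erase j).card ≤ n := by
      have h5 := Finset.card_erase_of_mem hS
      have h6 : S.card ≤ n + 1 := (Finset.card_le_univ S).trans (by rw [Fintype.card_fin])
      omega
    exact_mod_cast h4
  have hsplit : ∑ i ∈ S, Real.cos (dist (x i) y) * Real.cos (dist (x i) z) =
      Real.cos (dist (x j) y) * a + ∑ i ∈ S.erase j, Real.cos (dist (x i) y) * Real.cos (dist (x i) z) := by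
    rw [← Finset.add_sum_erase S _ hS]
  rw [hsplit]
  have hcj : |Real.cos (dist (x j) y)| ≤ 1 := Real.abs_cos_le_one _
  have hd0 : 0 ≤ dist (x j) z := dist_nonneg
  have hdπ : dist (x j) z ≤ Real.pi := hdiam _ _
  -- the two sub-cases
  rcases le_or_gt 0 a with hapos | haneg
  · -- `a ≥ 1 − γ`: `z` is close to `x_j`
    have ha' : 1 - γ ≤ a := by rwa [abs_of_nonneg hapos] at hj
    have hdist : dist (x j) z ≤ Real.pi * Real.sqrt (γ / 2) :=
      le_pi_mul_sqrt_of_one_sub_cos_le hd0 hdπ (by rw [← ha]; linarith)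
    have h1 : |Real.cos (dist y z) - Real.cos (dist (x j) y)| ≤ Real.pi * Real.sqrt (γ / 2) := by
      rw [dist_comm (x j) y]
      exact (abs_cos_dist_sub_cos_dist_le y z (x j)).trans (by rwa [dist_comm])
    have h2 : |Real.cos (dist (x j) y) - Real.cos (dist (x j) y) * a| ≤ γ := by
      rw [← mul_one_sub, abs_mul]
      have h3 : |1 - a| ≤ γ := by rw [abs_of_nonneg (by linarith [ha1, le_abs_self a])]; linarith
      calc |Real.cos (dist (x j) y)| * |1 - a| ≤ 1 * γ := mul_le_mul hcj h3 (abs_nonneg _) zero_le_one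
        _ = γ := one_mul γ
    have h4 := abs_sub_le (Real.cos (dist y z)) (Real.cos (dist (x j) y)) (Real.cos (dist (x j) y) * a)
    have h5 := abs_sub_le (Real.cos (dist y z)) (Real.cos (dist (x j) y) * a)
      (Real.cos (dist (x j) y) * a + ∑ i ∈ S.erase j, Real.cos (dist (x i) y) * Real.cos (dist (x i) z))
    rw [show Real.cos (dist (x j) y) * a -
      (Real.cos (dist (x j) y) * a + ∑ i ∈ S.erase j, Real.cos (dist (x i) y) * Real.cos (dist (x i) z)) =
      -(∑ i ∈ S.erase j, Real.cos (dist (x i) y) * Real.cos (dist (x i) z)) by ring, abs_neg] at h5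
    linarith [Real.sqrt_nonneg (γ / 2), Real.pi_pos.le]
  · -- `a ≤ −(1 − γ)`: `z` is almost antipodal to `x_j`
    have ha' : a ≤ -(1 - γ) := by rw [abs_of_neg haneg] at hj; linarith
    have hdist : Real.pi - ψ₀ ≤ dist (x j) z := by
      have h1 : Real.pi - dist (x j) z ≤ Real.pi * Real.sqrt (γ / 2) := by
        refine le_pi_mul_sqrt_of_one_sub_cos_le (by linarith) (by linarith) ?_
        rw [Real.cos_pi_sub, ← ha]; linarith
      linarith
    have h1 : |Real.cos (dist y z) + Real.cos (dist (x j) y)| ≤ η₂ := by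
      have := hanti2 (x j) z hdist y
      rwa [dist_comm z y, add_comm] at this
    have h2 : |Real.cos (dist (x j) y) + Real.cos (dist (x j) y) * a| ≤ γ := by
      rw [← mul_one_add, abs_mul]
      have h3 : |1 + a| ≤ γ := by
        rw [abs_of_nonneg (by linarith [ha1, neg_abs_le a])]; linarith
      calc |Real.cos (dist (x j) y)| * |1 + a| ≤ 1 * γ := mul_le_mul hcj h3 (abs_nonneg _) zero_le_one
        _ = γ := one_mul γ
    have h4 : |Real.cos (dist y z) - Real.cos (dist (x j) y) * a| ≤ η₂ + γ := by
      have e1 : Real.cos (dist y z) - Real.cos (dist (x j) y) * a =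
          (Real.cos (dist y z) + Real.cos (dist (x j) y)) -
            (Real.cos (dist (x j) y) + Real.cos (dist (x j) y) * a) := by ring
      rw [e1]
      exact (abs_sub _ _).trans (by linarith)
    have h5 := abs_sub_le (Real.cos (dist y z)) (Real.cos (dist (x j) y) * a)
      (Real.cos (dist (x j) y) * a + ∑ i ∈ S.erase j, Real.cos (dist (x i) y) * Real.cos (dist (x i) z))
    rw [show Real.cos (dist (x j) y) * a -
      (Real.cos (dist (x j) y) * a + ∑ i ∈ S.erase j, Real.cos (dist (x i) y) * Real.cos (dist (x i) z)) =
      -(∑ i ∈ S.erase j, Real.cos (dist (x i) y) * Real.cos (dist (x i) z)) by ring, abs_neg] at h5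
    have : 0 ≤ Real.pi * Real.sqrt (γ / 2) := by positivity
    linarith


/-! ### The generic step -/

/-- **The analysis step** (see the module docstring): from a source `p₀` realising `σ e_j` with
`σ cos d(x_j, z) = −|cos d(x_j, z)|`, `|cos d(x_j, z)| < 1 − γ`, and a continuous good path from
`≈ p₀` to `≈ z`, a point `q` on the path with `|cos d(x_j, q)| ≤ r` and a factor
`B ∈ [1/4, 1/√(γ/2)]` with `cos d_{x_i}(q) ≈ B cos d_{x_i}(z)` (`i ≠ j`) and
`cos d_y(q) ≈ B (cos d_y(z) − cos d(x_j, z) cos d(x_j, y))`, errors `ε₃/√(γ/2)`, `2ε₃/√(γ/2)`,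
`ε₃ = α + β + η + 3r`. [cite: Colding1996Shape, §2] -/
theorem analysis_step {n : ℕ} (x : Fin (n + 1) → M) (y z : M) {γ α β r η : ℝ}
    (hγ0 : 0 < γ) (hγ1 : γ ≤ 1) (hα : 0 ≤ α) (hβ : 0 ≤ β) (hr : 0 ≤ r) (hη : 0 ≤ η)
    (hsmall₁ : η + 2 * r ≤ γ / 2) (hsmall₂ : α + β + η + 3 * r ≤ Real.sqrt (γ / 2) / 2)
    (hdiam : ∀ a b : M, dist a b ≤ Real.pi)
    (j : Fin (n + 1)) (hj : |Real.cos (dist (x j) z)| < 1 - γ)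
    {σ : ℝ} (hσ : σ = 1 ∨ σ = -1) (hσa : σ * Real.cos (dist (x j) z) = -|Real.cos (dist (x j) z)|)
    {p₀ : M} (hp1 : ∀ i, |Real.cos (dist (x i) p₀) - (if i = j then σ else 0)| ≤ α + η)
    (hp2 : ∀ w, |Real.cos (dist p₀ w) - σ * Real.cos (dist (x j) w)| ≤ η)
    {z₁ z₂ : M} {pth : ℝ → M} (hz₁ : dist p₀ z₁ ≤ r) (hz₂ : dist z z₂ ≤ r)
    (hpc : Continuous pth) (hp0 : pth 0 = z₁) (hp1' : pth 1 = z₂)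
    (hlawx : ∀ i, ∀ s ∈ Icc (0:ℝ) 1,
      |Real.sin (dist z₁ z₂) * Real.cos (dist (x i) (pth s)) -
        (Real.sin ((1 - s) * dist z₁ z₂) * Real.cos (dist (x i) z₁) +
          Real.sin (s * dist z₁ z₂) * Real.cos (dist (x i) z₂))| ≤ β)
    (hlawy : ∀ s ∈ Icc (0:ℝ) 1,
      |Real.sin (dist z₁ z₂) * Real.cos (dist y (pth s)) -
        (Real.sin ((1 - s) * dist z₁ z₂) * Real.cos (dist y z₁) +
          Real.sin (s * dist z₁ z₂) * Real.cos (dist y z₂))| ≤ β) :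
    ∃ (q : M) (B : ℝ), |Real.cos (dist (x j) q)| ≤ r ∧ 1 / 4 ≤ B ∧ B ≤ 1 / Real.sqrt (γ / 2) ∧
      (∀ i, i ≠ j → |Real.cos (dist (x i) q) - B * Real.cos (dist (x i) z)| ≤
        (α + β + η + 3 * r) / Real.sqrt (γ / 2)) ∧
      |Real.cos (dist y q) - B * (Real.cos (dist y z) - Real.cos (dist (x j) z) * Real.cos (dist (x j) y))| ≤
        2 * ((α + β + η + 3 * r) / Real.sqrt (γ / 2)) := by
  set a : ℝ := Real.cos (dist (x j) z) with ha
  set sg : ℝ := Real.sqrt (γ / 2) with hsg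
  set ε₃ : ℝ := α + β + η + 3 * r with hε₃
  have hsg0 : 0 < sg := Real.sqrt_pos.2 (by positivity)
  have hsg1 : sg ≤ 1 := by
    calc sg = Real.sqrt (γ / 2) := rfl
      _ ≤ Real.sqrt 1 := Real.sqrt_le_sqrt (by linarith)
      _ = 1 := Real.sqrt_one
  have hsg2 : sg ^ 2 = γ / 2 := Real.sq_sqrt (by positivity)
  have ha1 : |a| ≤ 1 := Real.abs_cos_le_one _
  have hσ1 : |σ| = 1 := by rcases hσ with h0 | h0 <;> simp [h0]
  have hσ2 : σ * σ = 1 := by rcases hσ with h0 | h0 <;> simp [h0]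
  have hε₃0 : 0 ≤ ε₃ := by positivity
  -- `sin ℓ ≥ sg`
  set ℓ : ℝ := dist z₁ z₂ with hℓ
  have hℓ0 : 0 ≤ ℓ := dist_nonneg
  have hℓπ : ℓ ≤ Real.pi := hdiam z₁ z₂
  have hcosℓ : |Real.cos ℓ| ≤ 1 - γ / 2 := by
    have h1 : |ℓ - dist p₀ z| ≤ 2 * r := by
      have h2 := abs_dist_sub_dist_le z₁ z₂ p₀ z
      have h3 : ℓ = dist z₁ z₂ := rfl
      linarith only [h2, h3, hz₁, hz₂]
    have h2 := Real.abs_cos_sub_cos_le ℓ (dist p₀ z)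
    have h3 : |Real.cos (dist p₀ z)| ≤ |a| + η := by
      have h4 := hp2 z
      have h5 := abs_sub_abs_le_abs_sub (Real.cos (dist p₀ z)) (σ * a)
      rw [abs_mul, hσ1, one_mul] at h5
      linarith only [h4, h5]
    have h6 := abs_sub_abs_le_abs_sub (Real.cos ℓ) (Real.cos (dist p₀ z))
    linarith only [h1, h2, h3, h6, hj, hsmall₁]
  have hsinℓ : sg ≤ Real.sin ℓ := by
    have h1 : γ / 2 ≤ Real.sin ℓ ^ 2 := by
      rw [Real.sin_sq]
      have h2 : Real.cos ℓ ^ 2 ≤ (1 - γ / 2) ^ 2 := by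
        rw [← sq_abs (Real.cos ℓ)]
        exact pow_le_pow_left₀ (abs_nonneg _) hcosℓ 2
      nlinarith only [h2, hγ0, hγ1]
    have h3 : 0 ≤ Real.sin ℓ := Real.sin_nonneg_of_nonneg_of_le_pi hℓ0 hℓπ
    rw [← hsg2] at h1
    exact le_of_pow_le_pow_left₀ two_ne_zero h3 h1
  have hsinpos : 0 < Real.sin ℓ := lt_of_lt_of_le hsg0 hsinℓ
  -- IVT: `|cos d(x_j, q)| ≤ r` for some `q = pth s*`
  have hgc : Continuous fun s : ℝ ↦ σ * Real.cos (dist (x j) (pth s)) :=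
    continuous_const.mul (Real.continuous_cos.comp (continuous_const.dist hpc))
  have hg0 : 0 < σ * Real.cos (dist (x j) (pth 0)) := by
    rw [hp0]
    have h1 : |Real.cos (dist (x j) z₁) - Real.cos (dist (x j) p₀)| ≤ r :=
      (abs_cos_dist_sub_cos_dist_le (x j) z₁ p₀).trans (by rw [dist_comm]; exact hz₁)
    have h2 := hp1 j
    rw [if_pos rfl] at h2
    have h3 : |σ * Real.cos (dist (x j) z₁) - 1| ≤ α + η + r := by
      have e1 : σ * Real.cos (dist (x j) z₁) - 1 =
          σ * (Real.cos (dist (x j) z₁) - Real.cos (dist (x j) p₀)) +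
            σ * (Real.cos (dist (x j) p₀) - σ) := by
        have : σ * σ = 1 := hσ2
        linear_combination this
      rw [e1]
      refine (abs_add_le _ _).trans ?_
      rw [abs_mul, abs_mul, hσ1, one_mul, one_mul]
      linarith only [h1, h2]
    have h4 := (abs_le.1 h3).1
    have h5 : α + η + r < 1 := by
      have : Real.sqrt (γ / 2) / 2 ≤ 1 / 2 := by linarith only [hsg1]
      linarith only [hsmall₂, this, hr, hβ]
    linarith only [h4, h5]
  have hz₂a : |Real.cos (dist (x j) z₂) - a| ≤ r :=
    (abs_cos_dist_sub_cos_dist_le (x j) z₂ z).trans (by rw [dist_comm]; exact hz₂)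
  obtain ⟨sstar, hsstar, hqj⟩ : ∃ s ∈ Icc (0:ℝ) 1, (|Real.cos (dist (x j) (pth s))| ≤ r) := by
    by_cases hg1 : σ * Real.cos (dist (x j) (pth 1)) ≤ 0
    · obtain ⟨s, hs, hs0⟩ : ∃ s ∈ Icc (0:ℝ) 1, σ * Real.cos (dist (x j) (pth s)) = 0 :=
        intermediate_value_Icc' zero_le_one hgc.continuousOn ⟨hg1, hg0.le⟩
      refine ⟨s, hs, ?_⟩
      have hσ0 : σ ≠ 0 := by intro h0; rw [h0, abs_zero] at hσ1; exact zero_ne_one hσ1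
      rcases mul_eq_zero.1 hs0 with h1 | h1
      · exact absurd h1 hσ0
      · rw [h1, abs_zero]; exact hr
    · refine ⟨1, ⟨zero_le_one, le_rfl⟩, ?_⟩
      push Not at hg1
      rw [hp1'] at hg1 ⊢
      -- `σ cos d(x_j, z₂) = −|a| ± r > 0 ⇒ |cos d(x_j, z₂)| ≤ r`
      have h1 : |σ * (Real.cos (dist (x j) z₂) - a)| ≤ r := by rw [abs_mul, hσ1, one_mul]; exact hz₂a
      have h2 := (abs_le.1 h1).2
      have h3 : |Real.cos (dist (x j) z₂)| = σ * Real.cos (dist (x j) z₂) := by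
        have h4 : |σ * Real.cos (dist (x j) z₂)| = |Real.cos (dist (x j) z₂)| := by
          rw [abs_mul, hσ1, one_mul]
        rw [← h4, abs_of_pos hg1]
      rw [h3]
      have h5 : σ * (Real.cos (dist (x j) z₂) - a) = σ * Real.cos (dist (x j) z₂) + |a| := by
        rw [mul_sub, hσa]; ring
      linarith only [h2, h5, abs_nonneg a]
  set q : M := pth sstar with hq
  set A : ℝ := Real.sin ((1 - sstar) * ℓ) / Real.sin ℓ with hA
  set B : ℝ := Real.sin (sstar * ℓ) / Real.sin ℓ with hB
  have hs0 : 0 ≤ sstar := hsstar.1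
  have hs1 : sstar ≤ 1 := hsstar.2
  have hA0 : 0 ≤ A := div_nonneg (Real.sin_nonneg_of_nonneg_of_le_pi (by nlinarith) (by nlinarith)) hsinpos.le
  have hB0 : 0 ≤ B := div_nonneg (Real.sin_nonneg_of_nonneg_of_le_pi (by nlinarith) (by nlinarith)) hsinpos.le
  have hinv : 1 / Real.sin ℓ ≤ 1 / sg := one_div_le_one_div_of_le hsg0 hsinℓ
  have hA1 : A ≤ 1 / sg := (div_le_div_of_nonneg_right (Real.sin_le_one _) hsinpos.le).trans hinv
  have hB1 : B ≤ 1 / sg := (div_le_div_of_nonneg_right (Real.sin_le_one _) hsinpos.le).trans hinv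
  have hAB : 1 ≤ A + B := by
    rw [hA, hB, ← add_div, le_div_iff₀ hsinpos, one_mul]
    exact sin_le_sin_add_sin hℓ0 hℓπ hs0 hs1
  -- dividing a law by `sin ℓ`
  have hdiv : ∀ {U U₁ U₂ : ℝ},
      |Real.sin ℓ * U - (Real.sin ((1 - sstar) * ℓ) * U₁ + Real.sin (sstar * ℓ) * U₂)| ≤ β →
      |U - (A * U₁ + B * U₂)| ≤ β / sg := by
    intro U U₁ U₂ h
    have h1 : |U - (A * U₁ + B * U₂)| * Real.sin ℓ ≤ β := by
      rw [← abs_of_pos hsinpos, ← abs_mul]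
      have hA' : A * Real.sin ℓ = Real.sin ((1 - sstar) * ℓ) := div_mul_cancel₀ _ hsinpos.ne'
      have hB' : B * Real.sin ℓ = Real.sin (sstar * ℓ) := div_mul_cancel₀ _ hsinpos.ne'
      have e1 : (U - (A * U₁ + B * U₂)) * Real.sin ℓ =
          Real.sin ℓ * U - (Real.sin ((1 - sstar) * ℓ) * U₁ + Real.sin (sstar * ℓ) * U₂) := by
        rw [← hA', ← hB']; ring
      rw [e1]; exact h
    rw [le_div_iff₀ hsg0]
    exact (mul_le_mul_of_nonneg_left hsinℓ (abs_nonneg _)).trans h1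
  -- the `x_j`-law: `abs (A − B |a|) ≤ ε₃ / sg`
  have hAj : |A - B * (abs a)| ≤ ε₃ / sg := by
    have h1 := hdiv (hlawx j sstar hsstar)
    have hz₁' : |σ * Real.cos (dist (x j) z₁) - 1| ≤ α + η + r := by
      have h2 : |Real.cos (dist (x j) z₁) - Real.cos (dist (x j) p₀)| ≤ r :=
        (abs_cos_dist_sub_cos_dist_le (x j) z₁ p₀).trans (by rw [dist_comm]; exact hz₁)
      have h3 := hp1 j
      rw [if_pos rfl] at h3
      have e1 : σ * Real.cos (dist (x j) z₁) - 1 =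
          σ * (Real.cos (dist (x j) z₁) - Real.cos (dist (x j) p₀)) +
            σ * (Real.cos (dist (x j) p₀) - σ) := by
        have : σ * σ = 1 := hσ2
        linear_combination this
      rw [e1]
      refine (abs_add_le _ _).trans ?_
      rw [abs_mul, abs_mul, hσ1, one_mul, one_mul]
      linarith only [h2, h3]
    have hz₂' : |σ * Real.cos (dist (x j) z₂) + (abs a)| ≤ r := by
      have e1 : σ * Real.cos (dist (x j) z₂) + |a| = σ * (Real.cos (dist (x j) z₂) - a) := by
        rw [mul_sub, hσa]; ring
      rw [e1, abs_mul, hσ1, one_mul]; exact hz₂a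
    -- `σ u_j(q) = σ A u_j(z₁) + σ B u_j(z₂) ± β/sg`
    have h4 : |σ * Real.cos (dist (x j) q) -
        (A * (σ * Real.cos (dist (x j) z₁)) + B * (σ * Real.cos (dist (x j) z₂)))| ≤ β / sg := by
      have e1 : σ * Real.cos (dist (x j) q) -
          (A * (σ * Real.cos (dist (x j) z₁)) + B * (σ * Real.cos (dist (x j) z₂))) =
          σ * (Real.cos (dist (x j) q) - (A * Real.cos (dist (x j) z₁) + B * Real.cos (dist (x j) z₂))) := by
        ring
      rw [e1, abs_mul, hσ1, one_mul]; exact h1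
    have h5 : |σ * Real.cos (dist (x j) q)| ≤ r := by rw [abs_mul, hσ1, one_mul]; exact hqj
    -- `A σu_j(z₁) + B σu_j(z₂) = A (1 + e₁) + B (−|a| + e₂)`
    have h6 : |A * (σ * Real.cos (dist (x j) z₁) - 1)| ≤ 1 / sg * (α + η + r) := by
      rw [abs_mul, abs_of_nonneg hA0]; exact mul_le_mul hA1 hz₁' (abs_nonneg _) (by positivity)
    have h7 : |B * (σ * Real.cos (dist (x j) z₂) + |a|)| ≤ 1 / sg * r := by
      rw [abs_mul, abs_of_nonneg hB0]; exact mul_le_mul hB1 hz₂' (abs_nonneg _) (by positivity)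
    have h8 : |A * (σ * Real.cos (dist (x j) z₁)) + B * (σ * Real.cos (dist (x j) z₂))| ≤ r + β / sg := by
      have := abs_sub_abs_le_abs_sub (A * (σ * Real.cos (dist (x j) z₁)) + B * (σ * Real.cos (dist (x j) z₂)))
        (σ * Real.cos (dist (x j) q))
      rw [abs_sub_comm] at h4
      linarith only [this, h4, h5]
    have h9 : r ≤ r / sg := by
      rw [le_div_iff₀ hsg0]; nlinarith only [hr, hsg1]
    have e2 : A - B * |a| = (A * (σ * Real.cos (dist (x j) z₁)) + B * (σ * Real.cos (dist (x j) z₂))) +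
        (-(A * (σ * Real.cos (dist (x j) z₁) - 1))) + (-(B * (σ * Real.cos (dist (x j) z₂) + |a|))) := by
      ring
    rw [e2]
    refine (abs_add_three _ _ _).trans ?_
    rw [abs_neg, abs_neg]
    have e3 : ε₃ / sg = (α + η + r) / sg + β / sg + r / sg + r / sg := by rw [hε₃]; ring
    have e4 : 1 / sg * (α + η + r) = (α + η + r) / sg := by ring
    have e5 : 1 / sg * r = r / sg := by ring
    rw [e3]
    rw [e4] at h6
    rw [e5] at h7
    linarith only [h6, h7, h8, h9]
  -- `B ≥ 1/4`
  have hB4 : 1 / 4 ≤ B := by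
    have h1 := (abs_le.1 hAj).2
    have h2 : ε₃ / sg ≤ 1 / 2 := by
      rw [div_le_iff₀ hsg0]; linarith only [hsmall₂]
    nlinarith only [hAB, h1, h2, ha1, abs_nonneg a, hB0]
  refine ⟨q, B, hqj, hB4, hB1, fun i hi ↦ ?_, ?_⟩
  · -- `i ≠ j`
    have h1 := hdiv (hlawx i sstar hsstar)
    have hz₁' : |Real.cos (dist (x i) z₁)| ≤ α + η + r := by
      have h2 : |Real.cos (dist (x i) z₁) - Real.cos (dist (x i) p₀)| ≤ r :=
        (abs_cos_dist_sub_cos_dist_le (x i) z₁ p₀).trans (by rw [dist_comm]; exact hz₁)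
      have h3 := hp1 i
      rw [if_neg hi, sub_zero] at h3
      have h4 := abs_sub_abs_le_abs_sub (Real.cos (dist (x i) z₁)) (Real.cos (dist (x i) p₀))
      linarith only [h2, h3, h4]
    have hz₂' : |Real.cos (dist (x i) z₂) - Real.cos (dist (x i) z)| ≤ r :=
      (abs_cos_dist_sub_cos_dist_le (x i) z₂ z).trans (by rw [dist_comm]; exact hz₂)
    have e1 : Real.cos (dist (x i) q) - B * Real.cos (dist (x i) z) =
        (Real.cos (dist (x i) q) - (A * Real.cos (dist (x i) z₁) + B * Real.cos (dist (x i) z₂))) +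
          A * Real.cos (dist (x i) z₁) + B * (Real.cos (dist (x i) z₂) - Real.cos (dist (x i) z)) := by ring
    rw [e1]
    have h6 : |A * Real.cos (dist (x i) z₁)| ≤ 1 / sg * (α + η + r) := by
      rw [abs_mul, abs_of_nonneg hA0]; exact mul_le_mul hA1 hz₁' (abs_nonneg _) (by positivity)
    have h7 : |B * (Real.cos (dist (x i) z₂) - Real.cos (dist (x i) z))| ≤ 1 / sg * r := by
      rw [abs_mul, abs_of_nonneg hB0]; exact mul_le_mul hB1 hz₂' (abs_nonneg _) (by positivity)
    refine (abs_add_three _ _ _).trans ?_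
    have h9 : 0 ≤ r / sg := by positivity
    have e3 : (α + β + η + 3 * r) / sg = (α + η + r) / sg + β / sg + r / sg + r / sg := by ring
    have e4 : 1 / sg * (α + η + r) = (α + η + r) / sg := by ring
    have e5 : 1 / sg * r = r / sg := by ring
    rw [e3]
    rw [e4] at h6
    rw [e5] at h7
    linarith only [h1, h6, h7, h9]
  · -- the test point
    have h1 := hdiv (hlawy sstar hsstar)
    have hz₁' : |Real.cos (dist y z₁) - σ * Real.cos (dist (x j) y)| ≤ η + r := by
      have h2 : |Real.cos (dist y z₁) - Real.cos (dist y p₀)| ≤ r :=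
        (abs_cos_dist_sub_cos_dist_le y z₁ p₀).trans (by rw [dist_comm]; exact hz₁)
      have h3 := hp2 y
      rw [dist_comm p₀ y] at h3
      have h4 := abs_sub_le (Real.cos (dist y z₁)) (Real.cos (dist y p₀)) (σ * Real.cos (dist (x j) y))
      linarith only [h2, h3, h4]
    have hz₂' : |Real.cos (dist y z₂) - Real.cos (dist y z)| ≤ r :=
      (abs_cos_dist_sub_cos_dist_le y z₂ z).trans (by rw [dist_comm]; exact hz₂)
    have hcj : |Real.cos (dist (x j) y)| ≤ 1 := Real.abs_cos_le_one _
    -- `σ |a| = −a`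
    have hσa' : σ * |a| = -a := by
      rcases hσ with h0 | h0
      · rw [h0] at hσa ⊢; linarith only [hσa]
      · rw [h0] at hσa ⊢; linarith only [hσa]
    have e1 : Real.cos (dist y q) - B * (Real.cos (dist y z) - a * Real.cos (dist (x j) y)) =
        (Real.cos (dist y q) - (A * Real.cos (dist y z₁) + B * Real.cos (dist y z₂))) +
          A * (Real.cos (dist y z₁) - σ * Real.cos (dist (x j) y)) +
          B * (Real.cos (dist y z₂) - Real.cos (dist y z)) +
          (A - B * |a|) * (σ * Real.cos (dist (x j) y)) := by
      have : B * |a| * (σ * Real.cos (dist (x j) y)) = B * (σ * |a|) * Real.cos (dist (x j) y) := by ring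
      rw [sub_mul, this, hσa']
      ring
    rw [e1]
    have h6 : |A * (Real.cos (dist y z₁) - σ * Real.cos (dist (x j) y))| ≤ 1 / sg * (η + r) := by
      rw [abs_mul, abs_of_nonneg hA0]; exact mul_le_mul hA1 hz₁' (abs_nonneg _) (by positivity)
    have h7 : |B * (Real.cos (dist y z₂) - Real.cos (dist y z))| ≤ 1 / sg * r := by
      rw [abs_mul, abs_of_nonneg hB0]; exact mul_le_mul hB1 hz₂' (abs_nonneg _) (by positivity)
    have h8 : |(A - B * |a|) * (σ * Real.cos (dist (x j) y))| ≤ ε₃ / sg := by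
      rw [abs_mul]
      have h9 : |σ * Real.cos (dist (x j) y)| ≤ 1 := by rw [abs_mul, hσ1, one_mul]; exact hcj
      calc |A - B * (abs a)| * |σ * Real.cos (dist (x j) y)| ≤ ε₃ / sg * 1 :=
            mul_le_mul hAj h9 (abs_nonneg _) (by positivity)
        _ = ε₃ / sg := mul_one _
    have t1 := abs_add_le (Real.cos (dist y q) - (A * Real.cos (dist y z₁) + B * Real.cos (dist y z₂)) +
          A * (Real.cos (dist y z₁) - σ * Real.cos (dist (x j) y)) +
          B * (Real.cos (dist y z₂) - Real.cos (dist y z)))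
        ((A - B * |a|) * (σ * Real.cos (dist (x j) y)))
    have t2 := abs_add_three (Real.cos (dist y q) - (A * Real.cos (dist y z₁) + B * Real.cos (dist y z₂)))
        (A * (Real.cos (dist y z₁) - σ * Real.cos (dist (x j) y)))
        (B * (Real.cos (dist y z₂) - Real.cos (dist y z)))
    have h10 : 0 ≤ α / sg := by positivity
    have h11 : 0 ≤ r / sg := by positivity
    have e3 : 2 * ((α + β + η + 3 * r) / sg) =
        β / sg + (η + r) / sg + r / sg + ε₃ / sg + (α / sg + r / sg) := by rw [hε₃]; ring
    have e4 : 1 / sg * (η + r) = (η + r) / sg := by ring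
    have e5 : 1 / sg * r = r / sg := by ring
    rw [e3]
    rw [e4] at h6
    rw [e5] at h7
    linarith only [t1, t2, h1, h6, h7, h8, h10, h11]


/-! ### The almost isometry -/

/-- **Colding's almost isometry, synthetic form** (see the module docstring): under the frame
relations (`α`), frame antipodes (`η`), the coarse antipodal relation (`ψ₀ ≥ π√(γ/2)`, `η₂`),
continuous good paths for `x, y` (`β`, `r`), `d ≤ π`, the two-sided Parseval bound (`ψ_P`) and
the smallness conditions `α, β, η, r ≤ ε`, `3ε ≤ γ/2`, `6ε ≤ √(γ/2)/2`,
`ψ_P + n (n (6ε/√(γ/2)) / √(γ/2)ⁿ)² ≤ γ` (`0 < γ ≤ 1`): for every `z`,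
`|cos d(y, z) − Σ_i cos d(x_i, y) cos d(x_i, z)| ≤ 5ⁿ⁺¹ (π√(γ/2) + η₂ + γ + n√(2γ + ψ_P) + 4(n+3)(6ε/√(γ/2)))`.
[cite: Colding1996Shape, §2] -/
theorem abs_cos_dist_sub_sum_le {n : ℕ} (x : Fin (n + 1) → M) (y : M)
    {γ ψ₀ η₂ ψP α β r η ε : ℝ} (hγ0 : 0 < γ) (hγ1 : γ ≤ 1) (hψP : 0 ≤ ψP) (hη₂ : 0 ≤ η₂)
    (hψ₀ : Real.pi * Real.sqrt (γ / 2) ≤ ψ₀)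
    (hα : 0 ≤ α) (hβ : 0 ≤ β) (hr : 0 ≤ r) (hη : 0 ≤ η)
    (hαε : α ≤ ε) (hβε : β ≤ ε) (hrε : r ≤ ε) (hηε : η ≤ ε)
    (hε₁ : 3 * ε ≤ γ / 2) (hε₂ : 6 * ε ≤ Real.sqrt (γ / 2) / 2)
    (hbase : ψP + n * (n * (6 * ε / Real.sqrt (γ / 2)) / Real.sqrt (γ / 2) ^ n) ^ 2 ≤ γ)
    (hdiam : ∀ a b : M, dist a b ≤ Real.pi)
    (hframe : ∀ i i', i ≠ i' → |Real.cos (dist (x i) (x i'))| ≤ α)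
    (hanti : ∀ i, ∃ xb : M, ∀ w, |Real.cos (dist (x i) w) + Real.cos (dist xb w)| ≤ η)
    (hanti2 : ∀ p q : M, Real.pi - ψ₀ ≤ dist p q →
      ∀ w, |Real.cos (dist p w) + Real.cos (dist q w)| ≤ η₂)
    (hP : ∀ z, |∑ i, Real.cos (dist (x i) z) ^ 2 - 1| ≤ ψP)
    (hgood : ∀ y₁ y₂ : M, ∃ (z₁ z₂ : M) (pth : ℝ → M), dist y₁ z₁ ≤ r ∧ dist y₂ z₂ ≤ r ∧
      Continuous pth ∧ pth 0 = z₁ ∧ pth 1 = z₂ ∧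
      (∀ i, ∀ s ∈ Icc (0:ℝ) 1,
        |Real.sin (dist z₁ z₂) * Real.cos (dist (x i) (pth s)) -
          (Real.sin ((1 - s) * dist z₁ z₂) * Real.cos (dist (x i) z₁) +
            Real.sin (s * dist z₁ z₂) * Real.cos (dist (x i) z₂))| ≤ β) ∧
      (∀ s ∈ Icc (0:ℝ) 1,
        |Real.sin (dist z₁ z₂) * Real.cos (dist y (pth s)) -
          (Real.sin ((1 - s) * dist z₁ z₂) * Real.cos (dist y z₁) +
            Real.sin (s * dist z₁ z₂) * Real.cos (dist y z₂))| ≤ β)) (z : M) :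
    |Real.cos (dist y z) - ∑ i, Real.cos (dist (x i) y) * Real.cos (dist (x i) z)| ≤
      5 ^ (n + 1) * (Real.pi * Real.sqrt (γ / 2) + η₂ + γ + n * Real.sqrt (2 * γ + ψP) +
        4 * (n + 3) * (6 * ε / Real.sqrt (γ / 2))) := by
  classical
  set sg : ℝ := Real.sqrt (γ / 2) with hsg
  have hsg0 : 0 < sg := Real.sqrt_pos.2 (by positivity)
  have hsg1 : sg ≤ 1 := by
    calc sg = Real.sqrt (γ / 2) := rfl
      _ ≤ Real.sqrt 1 := Real.sqrt_le_sqrt (by linarith)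
      _ = 1 := Real.sqrt_one
  have hε0 : 0 ≤ ε := hα.trans hαε
  set e4 : ℝ := 6 * ε / sg with he4
  have he40 : 0 ≤ e4 := by positivity
  set D : ℝ := Real.pi * Real.sqrt (γ / 2) + η₂ + γ + n * Real.sqrt (2 * γ + ψP) with hD
  have hD0 : 0 ≤ D := by positivity
  set K : ℝ := D + 4 * (n + 3) * e4 with hK
  have hK0 : 0 ≤ K := by positivity
  have hKD : D ≤ K := by
    have : (0:ℝ) ≤ 4 * (n + 3) * e4 := by positivity
    rw [hK]; linarith only [this]
  have hε₃ : α + β + η + 3 * r ≤ 6 * ε := by linarith only [hαε, hβε, hηε, hrε]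
  have hsmall₁ : η + 2 * r ≤ γ / 2 := by linarith only [hηε, hrε, hε₁]
  have hsmall₂ : α + β + η + 3 * r ≤ Real.sqrt (γ / 2) / 2 := hε₃.trans hε₂
  have hε₃sg : (α + β + η + 3 * r) / sg ≤ e4 := div_le_div_of_nonneg_right hε₃ hsg0.le
  -- thresholds and their monotonicity
  have hpowle : ∀ k : ℕ, sg ^ k ≤ 1 := fun k ↦ pow_le_one₀ hsg0.le hsg1
  have hpowpos : ∀ k : ℕ, 0 < sg ^ k := fun k ↦ pow_pos hsg0 k
  -- the claim, by induction on `m`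
  suffices H : ∀ m : ℕ, m ≤ n → ∀ z : M,
      (∀ i : Fin (n + 1), (i : ℕ) < n - m → |Real.cos (dist (x i) z)| ≤ (n - m : ℕ) * e4 / sg ^ (n - m)) →
      |Real.cos (dist y z) - ∑ i ∈ Finset.univ.filter (fun i : Fin (n + 1) ↦ n - m ≤ (i : ℕ)),
          Real.cos (dist (x i) y) * Real.cos (dist (x i) z)| ≤ 5 ^ (m + 1) * K by
    have h1 := H n le_rfl z (fun i hi ↦ absurd hi (by omega))
    have h2 : Finset.univ.filter (fun i : Fin (n + 1) ↦ n - n ≤ (i : ℕ)) = Finset.univ :=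
      Finset.filter_true_of_mem fun i _ ↦ by omega
    rw [h2] at h1
    exact h1
  intro m
  induction m with
  | zero =>
    intro _ z hz
    rw [Nat.sub_zero] at hz
    simp only [Nat.sub_zero, zero_add, pow_one]
    -- `|cos d(x_n, z)| ≥ 1 − γ` by Parseval
    have hlast : 1 - γ ≤ |Real.cos (dist (x (Fin.last n)) z)| := by
      have h1 := (abs_le.1 (hP z)).1
      have h2 : ∑ i, Real.cos (dist (x i) z) ^ 2 =
          Real.cos (dist (x (Fin.last n)) z) ^ 2 +
            ∑ i ∈ Finset.univ.erase (Fin.last n), Real.cos (dist (x i) z) ^ 2 :=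
        (Finset.add_sum_erase _ _ (Finset.mem_univ _)).symm
      have h3 : ∑ i ∈ Finset.univ.erase (Fin.last n), Real.cos (dist (x i) z) ^ 2 ≤
          n * (n * e4 / sg ^ n) ^ 2 := by
        have h4 : ∀ i ∈ Finset.univ.erase (Fin.last n), Real.cos (dist (x i) z) ^ 2 ≤ (n * e4 / sg ^ n) ^ 2 := by
          intro i hi
          have hi' : (i : ℕ) < n := by
            have h5 : i ≠ Fin.last n := Finset.ne_of_mem_erase hi
            have h6 : (i : ℕ) ≠ n := fun h0 ↦ h5 (Fin.ext (by simp [h0]))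
            have := i.isLt; omega
          have h7 := hz i hi'
          rw [← sq_abs]
          exact pow_le_pow_left₀ (abs_nonneg _) h7 2
        refine (Finset.sum_le_card_nsmul _ _ _ h4).trans ?_
        rw [Finset.card_erase_of_mem (Finset.mem_univ _), Finset.card_univ, Fintype.card_fin,
          Nat.add_sub_cancel, nsmul_eq_mul]
      have h8 : 1 - γ ≤ Real.cos (dist (x (Fin.last n)) z) ^ 2 := by
        linarith only [h1, h2, h3, hbase]
      have h9 : Real.cos (dist (x (Fin.last n)) z) ^ 2 ≤ |Real.cos (dist (x (Fin.last n)) z)| := by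
        rw [← sq_abs]
        have h10 := Real.abs_cos_le_one (dist (x (Fin.last n)) z)
        nlinarith only [abs_nonneg (Real.cos (dist (x (Fin.last n)) z)), h10]
      linarith only [h8, h9]
    have hS : Fin.last n ∈ Finset.univ.filter (fun i : Fin (n + 1) ↦ n ≤ (i : ℕ)) := by
      simp
    have hP' : ∑ i, Real.cos (dist (x i) z) ^ 2 ≤ 1 + ψP := by
      have := (abs_le.1 (hP z)).2; linarith
    have hdeg := abs_cos_dist_sub_sum_le_of_degenerate x y z hψP hη₂ hψ₀ hdiam hanti2 hP'
      (Fin.last n) hlast _ hS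
    exact hdeg.trans (by linarith only [hKD, hK0])
  | succ m ih =>
    intro hm z hz
    have hjlt : n - (m + 1) < n + 1 := by omega
    set jv : ℕ := n - (m + 1) with hjv
    set j : Fin (n + 1) := ⟨jv, hjlt⟩ with hjdef
    have hnm : n - m = jv + 1 := by omega
    set a : ℝ := Real.cos (dist (x j) z) with ha
    have ha1 : |a| ≤ 1 := Real.abs_cos_le_one _
    set S := Finset.univ.filter (fun i : Fin (n + 1) ↦ jv ≤ (i : ℕ)) with hSdef
    set S' := Finset.univ.filter (fun i : Fin (n + 1) ↦ jv + 1 ≤ (i : ℕ)) with hS'def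
    have hjS : j ∈ S := by simp [hSdef, hjdef]
    have hSS' : S.erase j = S' := by
      ext i
      simp only [hSdef, hS'def, Finset.mem_erase, Finset.mem_filter, Finset.mem_univ, true_and, hjdef]
      constructor
      · rintro ⟨h1, h2⟩
        have h3 : (i : ℕ) ≠ jv := fun h0 ↦ h1 (Fin.ext h0)
        omega
      · intro h1
        refine ⟨fun h0 ↦ ?_, by omega⟩
        rw [h0] at h1; simp at h1
    have hpow5 : (1 : ℝ) ≤ 5 ^ (m + 1) := one_le_pow₀ (by norm_num)
    by_cases hdegc : 1 - γ ≤ |a|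
    · -- degenerate
      have hP' : ∑ i, Real.cos (dist (x i) z) ^ 2 ≤ 1 + ψP := by
        have := (abs_le.1 (hP z)).2; linarith
      have hdeg := abs_cos_dist_sub_sum_le_of_degenerate x y z hψP hη₂ hψ₀ hdiam hanti2 hP'
        j hdegc S hjS
      refine hdeg.trans ?_
      have : (1 : ℝ) ≤ 5 ^ (m + 1 + 1) := one_le_pow₀ (by norm_num)
      nlinarith only [hKD, hK0, this]
    · -- generic
      push Not at hdegc
      set σ : ℝ := if 0 ≤ a then -1 else 1 with hσdef
      have hσ' : σ = 1 ∨ σ = -1 := by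
        by_cases h0 : 0 ≤ a
        · right; rw [hσdef, if_pos h0]
        · left; rw [hσdef, if_neg h0]
      have hσa : σ * a = -|a| := by
        by_cases h0 : 0 ≤ a
        · rw [hσdef, if_pos h0, abs_of_nonneg h0]; ring
        · rw [hσdef, if_neg h0, abs_of_neg (not_le.1 h0)]; ring
      obtain ⟨p₀, hp1, hp2⟩ := exists_cos_dist_realization_basis x hα hη hframe hanti j hσ'
      obtain ⟨z₁, z₂, pth, hz₁, hz₂, hpc, hp0, hp1', hlawx, hlawy⟩ := hgood p₀ z
      obtain ⟨q, B, hqj, hB4, hB1, hcoord, hyq⟩ := analysis_step x y z hγ0 hγ1 hα hβ hr hη hsmall₁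
        hsmall₂ hdiam j hdegc hσ' hσa hp1 hp2 hz₁ hz₂ hpc hp0 hp1' hlawx hlawy
      -- the induction hypothesis at `q`
      have hqcons : ∀ i : Fin (n + 1), (i : ℕ) < n - m →
          |Real.cos (dist (x i) q)| ≤ (n - m : ℕ) * e4 / sg ^ (n - m) := by
        intro i hi
        rw [hnm] at hi ⊢
        have hthr : e4 ≤ (((jv + 1 : ℕ) : ℝ)) * e4 / sg ^ (jv + 1) := by
          rw [le_div_iff₀ (hpowpos _)]
          have h1 : e4 * sg ^ (jv + 1) ≤ e4 * 1 := mul_le_mul_of_nonneg_left (hpowle _) he40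
          have h2 : (1 : ℝ) ≤ ((jv + 1 : ℕ) : ℝ) := by exact_mod_cast Nat.succ_le_succ (Nat.zero_le _)
          nlinarith only [h1, h2, he40]
        by_cases hij : i = j
        · rw [hij]
          have hre4 : r ≤ e4 := by
            rw [he4, le_div_iff₀ hsg0]; nlinarith only [hrε, hsg1, hr, hsg0]
          exact hqj.trans (hre4.trans hthr)
        · have hi' : (i : ℕ) < jv := by
            have : (i : ℕ) ≠ jv := fun h0 ↦ hij (Fin.ext h0)
            omega
          have h1 := hcoord i hij
          have h2 := hz i hi'
          have h3 : |Real.cos (dist (x i) q)| ≤ B * |Real.cos (dist (x i) z)| + e4 := by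
            have h4 := abs_sub_abs_le_abs_sub (Real.cos (dist (x i) q)) (B * Real.cos (dist (x i) z))
            rw [abs_mul, abs_of_nonneg (show (0:ℝ) ≤ B by linarith only [hB4])] at h4
            linarith only [h1, h4, hε₃sg]
          have h5 : B * |Real.cos (dist (x i) z)| ≤ (1 / sg) * ((jv : ℕ) * e4 / sg ^ jv) :=
            mul_le_mul hB1 h2 (abs_nonneg _) (by positivity)
          have h6 : (1 / sg) * ((jv : ℕ) * e4 / sg ^ jv) + e4 ≤ ((jv + 1 : ℕ) : ℝ) * e4 / sg ^ (jv + 1) := by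
            rw [pow_succ]
            have h7 : e4 ≤ e4 / (sg ^ jv * sg) := by
              rw [le_div_iff₀ (by positivity)]
              have : sg ^ jv * sg ≤ 1 := by
                calc sg ^ jv * sg ≤ 1 * 1 := mul_le_mul (hpowle _) hsg1 hsg0.le zero_le_one
                  _ = 1 := one_mul 1
              nlinarith only [this, he40]
            have e1 : (1 / sg) * ((jv : ℕ) * e4 / sg ^ jv) = (jv : ℕ) * e4 / (sg ^ jv * sg) := by
              field_simp
            have e2 : ((jv + 1 : ℕ) : ℝ) * e4 / (sg ^ jv * sg) = (jv : ℕ) * e4 / (sg ^ jv * sg) + e4 / (sg ^ jv * sg) := by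
              push_cast; ring
            rw [e1, e2]
            linarith only [h7]
          linarith only [h3, h5, h6]
      have hIH := ih (by omega) q hqcons
      rw [hnm] at hIH
      -- `Σ_{S'} c_i u_i(q) ≈ B Σ_{S'} c_i u_i(z)`
      have hS'bound : |∑ i ∈ S', Real.cos (dist (x i) y) * Real.cos (dist (x i) q) -
          B * ∑ i ∈ S', Real.cos (dist (x i) y) * Real.cos (dist (x i) z)| ≤ n * e4 := by
        rw [Finset.mul_sum, ← Finset.sum_sub_distrib]
        refine (Finset.abs_sum_le_sum_abs _ _).trans ?_
        have h1 : ∀ i ∈ S', |Real.cos (dist (x i) y) * Real.cos (dist (x i) q) -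
            B * (Real.cos (dist (x i) y) * Real.cos (dist (x i) z))| ≤ e4 := by
          intro i hi
          have hij : i ≠ j := by
            intro h0
            rw [h0, hS'def, Finset.mem_filter] at hi
            simp [hjdef] at hi
          have e1 : Real.cos (dist (x i) y) * Real.cos (dist (x i) q) -
              B * (Real.cos (dist (x i) y) * Real.cos (dist (x i) z)) =
              Real.cos (dist (x i) y) * (Real.cos (dist (x i) q) - B * Real.cos (dist (x i) z)) := by ring
          rw [e1, abs_mul]
          calc |Real.cos (dist (x i) y)| * |Real.cos (dist (x i) q) - B * Real.cos (dist (x i) z)|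
              ≤ 1 * e4 := mul_le_mul (Real.abs_cos_le_one _) ((hcoord i hij).trans hε₃sg)
                (abs_nonneg _) zero_le_one
            _ = e4 := one_mul _
        refine (Finset.sum_le_card_nsmul _ _ _ h1).trans ?_
        rw [nsmul_eq_mul]
        refine mul_le_mul_of_nonneg_right ?_ he40
        have h2 : S'.card ≤ n := by
          have h3 : S'.card + 1 = S.card := by
            rw [← hSS', Finset.card_erase_add_one hjS]
          have h4 : S.card ≤ n + 1 := (Finset.card_le_univ S).trans (by rw [Fintype.card_fin])
          omega
        exact_mod_cast h2
      -- combine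
      have hsplit : ∑ i ∈ S, Real.cos (dist (x i) y) * Real.cos (dist (x i) z) =
          Real.cos (dist (x j) y) * a + ∑ i ∈ S', Real.cos (dist (x i) y) * Real.cos (dist (x i) z) := by
        rw [← Finset.add_sum_erase S _ hjS, hSS']
      rw [hsplit]
      set T : ℝ := ∑ i ∈ S', Real.cos (dist (x i) y) * Real.cos (dist (x i) z) with hT
      set Tq : ℝ := ∑ i ∈ S', Real.cos (dist (x i) y) * Real.cos (dist (x i) q) with hTq
      have hyq' : |Real.cos (dist y q) - B * (Real.cos (dist y z) - a * Real.cos (dist (x j) y))| ≤ 2 * e4 :=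
        hyq.trans (by linarith only [hε₃sg])
      have hIH' : |Real.cos (dist y q) - Tq| ≤ 5 ^ (m + 1) * K := hIH
      -- `|B X| ≤ 5^(m+1) K + (n + 2) e4` with `X = u_y(z) − a c_j − T`
      have hBX : |B * (Real.cos (dist y z) - a * Real.cos (dist (x j) y) - T)| ≤
          5 ^ (m + 1) * K + (n + 2) * e4 := by
        have e1 : B * (Real.cos (dist y z) - a * Real.cos (dist (x j) y) - T) =
            -(Real.cos (dist y q) - B * (Real.cos (dist y z) - a * Real.cos (dist (x j) y))) +
              (Real.cos (dist y q) - Tq) + (Tq - B * T) := by ring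
        rw [e1]
        refine (abs_add_three _ _ _).trans ?_
        rw [abs_neg]
        linarith only [hyq', hIH', hS'bound]
      have hX : |Real.cos (dist y z) - a * Real.cos (dist (x j) y) - T| ≤
          4 * (5 ^ (m + 1) * K + (n + 2) * e4) := by
        have h1 : |B * (Real.cos (dist y z) - a * Real.cos (dist (x j) y) - T)| =
            B * |Real.cos (dist y z) - a * Real.cos (dist (x j) y) - T| := by
          rw [abs_mul, abs_of_nonneg (show (0:ℝ) ≤ B by linarith only [hB4])]
        rw [h1] at hBX
        nlinarith only [hBX, hB4, abs_nonneg (Real.cos (dist y z) - a * Real.cos (dist (x j) y) - T)]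
      have e2 : Real.cos (dist y z) - (Real.cos (dist (x j) y) * a + T) =
          Real.cos (dist y z) - a * Real.cos (dist (x j) y) - T := by ring
      rw [e2]
      refine hX.trans ?_
      have e3 : (5 : ℝ) ^ (m + 1 + 1) * K = 5 * (5 ^ (m + 1) * K) := by ring
      rw [e3]
      have h2 : 4 * ((n : ℝ) + 2) * e4 ≤ K := by rw [hK]; linarith only [hD0, he40]
      nlinarith only [h2, hpow5, hK0, he40]

end ColdingSynthetic

end Literature.Geometry.Riemannian

end
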